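import Summits.Parity.GeneralizedHardyLittlewood.Theses.LiouvilleShiftedTables
import Summits.Parity.GeneralizedHardyLittlewood.Theorems.DilatedTableChowla.Negative.DilatedTableChowlaBlocks
import Summits.Parity.GeneralizedHardyLittlewood.Theorems.TableChowla.Negative.TableChowlaAperiodicVacuity

/-!
# Crux-triage r2-1 evidence — crux `DilatedTableChowla` (stmt-Parity-14271), round 2, triager 1

Kernel-checked facts behind the two verdicts of `TRIAGE-r2-1.md` (refuter-cruxtri-stmt-Parity-14271-r2-1-0).
The `Prop`s are restated VERBATIM from `Cruxes/DilatedTableChowla/SketchIdeator4.lean` (ideator 4, the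
sketch behind both round-2 cards; a crux workfile, not importable) over the landed block notation
`rows / cols / L / lhs` of `Theorems/DilatedTableChowla/Negative/DilatedTableChowlaBlocks`.

* §A (card `dilated-symbol-normal-form`): BOTH halves of the card's "exact split"
  `DilatedTableChowla ↔ ZeroClassDilated ∧ NonzeroClassDilated` contain the sibling crux
  `TableChowla` (stmt-Parity-14270) verbatim — the `q = 1` term of `lhs` is the plain table for every
  selector pair, and zero-class / non-zero-class selectors exist at every `q` (`tableChowla_of_zeroClassDilated`,
  `tableChowla_of_nonzeroClassDilated`).  So the split cuts nothing below the rank-2 crux whose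
  chain is dead (both lines) and whose ideation is dry; it only re-sorts the band item 14839 by class type.
* §B (card `cm-dichotomy-sections`): the periodic/aperiodic DICHOTOMY of the card is VOID as typed —
  `AperiodicSections → AllCMSections → PeriodicSections` for every `K` (kill one prime beyond the
  columns and beyond `(log x)^K`: the sibling's `aperiodic_killPrime`, p74937, verbatim mechanism).
  Hence `PeriodicSections`, and with it the card's whole "closable-now" spine
  `RelativeLinnikData ⟹ ThinFamilyBV ⟹ PeriodicSections`, is logically redundant in `CardTwoAssembly`;
  the two-point content is `InverseCMSections ∧ AllCMSections`, i.e. the dead sibling line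
  `helson-kronecker-inverse` (`InverseCM ∧ MeanSquareCM`) transported to class sections.
-/

namespace Summit.Parity.GeneralizedHardyLittlewood.Cruxes.DilatedTableChowla.TriageR2K1

open Finset
open Summit.Parity.GeneralizedHardyLittlewood.Theses.LiouvilleShiftedTables
open Summit.Parity.GeneralizedHardyLittlewood.Theorems.DilatedTableChowla.Negative
open Summit.Parity.GeneralizedHardyLittlewood.Theorems.TableChowla.Negative
  (killPrime killPrime_mul norm_killPrime_le aperiodic_killPrime killPrime_of_not_dvd)

/-! ## §A  Card `dilated-symbol-normal-form`: both halves of the split contain `TableChowla` -/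

/-- VERBATIM from `SketchIdeator4`: the crux restricted to selectors picking ZERO classes
(`q ∣ u_q v_q + c` at every dilation). -/
def ZeroClassDilated : Prop :=
  ∀ c : ℤ, c ≠ 0 → ∀ δ : ℝ, 0 < δ → δ ≤ 1 / 12 → ∀ C : ℝ, 0 < C → ∃ x₀ : ℝ, ∀ x : ℝ, x₀ ≤ x →
    ∀ A : ℝ, x ^ δ ≤ A → A ≤ x ^ (1 / 3 + δ) → ∀ u v : ℕ → ℕ,
      (∀ q : ℕ, 1 ≤ q → (q : ℤ) ∣ (u q : ℤ) * (v q : ℤ) + c) →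
        lhs c δ x A u v ≤ x ^ 2 / Real.log x ^ C

/-- VERBATIM from `SketchIdeator4`: the crux restricted to selectors picking NON-zero classes at
every dilation `q ≥ 2`. -/
def NonzeroClassDilated : Prop :=
  ∀ c : ℤ, c ≠ 0 → ∀ δ : ℝ, 0 < δ → δ ≤ 1 / 12 → ∀ C : ℝ, 0 < C → ∃ x₀ : ℝ, ∀ x : ℝ, x₀ ≤ x →
    ∀ A : ℝ, x ^ δ ≤ A → A ≤ x ^ (1 / 3 + δ) → ∀ u v : ℕ → ℕ,
      (∀ q : ℕ, 2 ≤ q → ¬ (q : ℤ) ∣ (u q : ℤ) * (v q : ℤ) + c) →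
        lhs c δ x A u v ≤ x ^ 2 / Real.log x ^ C

/-- The ZERO-class half (the only half the route's glue consumes) already contains the sibling crux
`TableChowla` (stmt-Parity-14270): choose the zero classes `u ≡ 1`, `v_q ≡ −c (mod q)` and keep the
`q = 1` term of `lhs`, which is the plain table. -/
theorem tableChowla_of_zeroClassDilated (h : ZeroClassDilated) : TableChowla := by
  intro c hc δ hδ hδ' C hC
  obtain ⟨x₀, hx₀⟩ := h c hc δ hδ hδ' C hC
  refine ⟨max x₀ 1, fun x hx A hA1 hA2 => ?_⟩
  have hx0 : x₀ ≤ x := le_trans (le_max_left _ _) hx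
  have hx1 : (1 : ℝ) ≤ x := le_trans (le_max_right _ _) hx
  have hsel : ∀ q : ℕ, 1 ≤ q →
      (q : ℤ) ∣ ((1 : ℕ) : ℤ) * ((Int.toNat ((-c) % (q : ℤ)) : ℕ) : ℤ) + c := by
    intro q hq
    have hq0 : (q : ℤ) ≠ 0 := by exact_mod_cast (show q ≠ 0 by omega)
    rw [Nat.cast_one, one_mul, Int.toNat_of_nonneg (Int.emod_nonneg _ hq0)]
    exact ⟨-((-c) / (q : ℤ)), by rw [Int.emod_def]; ring⟩
  have key := hx₀ x hx0 A hA1 hA2 (fun _ => 1) (fun q => Int.toNat ((-c) % (q : ℤ))) hsel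
  have h1 := F_one_le_lhs c hδ.le hx1 A (fun _ => 1) (fun q => Int.toNat ((-c) % (q : ℤ)))
  rw [F_one_eq_table] at h1
  exact h1.trans key

/-- The NON-zero-class half ("the surplus", by the card's own account harder-looking than 14270)
ALSO contains `TableChowla`: choose at every `q ≥ 2` the non-zero class `(1,1)` if `q ∣ c` and
`(0,0)` otherwise; the `q = 1` term of `lhs` is again the plain table. -/
theorem tableChowla_of_nonzeroClassDilated (h : NonzeroClassDilated) : TableChowla := by
  intro c hc δ hδ hδ' C hC
  obtain ⟨x₀, hx₀⟩ := h c hc δ hδ hδ' C hC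
  refine ⟨max x₀ 1, fun x hx A hA1 hA2 => ?_⟩
  have hx0 : x₀ ≤ x := le_trans (le_max_left _ _) hx
  have hx1 : (1 : ℝ) ≤ x := le_trans (le_max_right _ _) hx
  have hsel : ∀ q : ℕ, 2 ≤ q →
      ¬ (q : ℤ) ∣ ((if q ∣ c.natAbs then 1 else 0 : ℕ) : ℤ) *
          ((if q ∣ c.natAbs then 1 else 0 : ℕ) : ℤ) + c := by
    intro q hq
    by_cases hqc : q ∣ c.natAbs
    · have hqc' : (q : ℤ) ∣ c := Int.natCast_dvd.mpr hqc
      rw [if_pos hqc, Nat.cast_one, one_mul]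
      intro h1
      have hone : (q : ℤ) ∣ 1 := (dvd_add_left hqc').mp h1
      have hone' : q ∣ 1 := by exact_mod_cast hone
      have := Nat.le_of_dvd one_pos hone'
      omega
    · rw [if_neg hqc, Nat.cast_zero, zero_mul, zero_add]
      exact fun h1 => hqc (Int.natCast_dvd.mp h1)
  have key := hx₀ x hx0 A hA1 hA2 (fun q => if q ∣ c.natAbs then 1 else 0)
    (fun q => if q ∣ c.natAbs then 1 else 0) hsel
  have h1 := F_one_le_lhs c hδ.le hx1 A (fun q => if q ∣ c.natAbs then 1 else 0)
    (fun q => if q ∣ c.natAbs then 1 else 0)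
  rw [F_one_eq_table] at h1
  exact h1.trans key

/-! ## §B  Card `cm-dichotomy-sections`: the periodic / aperiodic dichotomy is void as typed -/

/-- VERBATIM from `SketchIdeator4`: `g` is `p`-periodic (on all of `ℕ`) for some `1 ≤ p ≤ P`. -/
def IsPeriodicUpTo (g : ℕ → ℂ) (P : ℝ) : Prop :=
  ∃ p : ℕ, 1 ≤ p ∧ (p : ℝ) ≤ P ∧ ∀ n, g (n + p) = g n

/-- VERBATIM from `SketchIdeator4`: (P) periodic residual at dilation `q`. -/
def PeriodicSections (c : ℤ) (x A : ℝ) (q u v : ℕ) (C' K : ℝ) : Prop :=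
  ∀ g : ℕ → ℂ, g 1 = 1 → (∀ m n : ℕ, g (m * n) = g m * g n) → (∀ n, ‖g n‖ ≤ 1) →
    IsPeriodicUpTo g (Real.log x ^ K) → ∀ y : ℝ, 0 ≤ y → y ≤ x / A →
      (∑ a ∈ rows A q u, ‖∑ b ∈ (cols x A q v).filter (fun b : ℕ => (b : ℝ) ≤ y),
          g b * (L ((a : ℤ) * b + c) : ℂ)‖ ^ 2) < (A / q) * (x / (A * q)) ^ 2 / Real.log x ^ C'

/-- VERBATIM from `SketchIdeator4`: (A) aperiodic residual at dilation `q` (the card's "one-sided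
two-point stub; open, binary-Elliott shaped"). -/
def AperiodicSections (c : ℤ) (x A : ℝ) (q u v : ℕ) (C' K : ℝ) : Prop :=
  ∀ g : ℕ → ℂ, g 1 = 1 → (∀ m n : ℕ, g (m * n) = g m * g n) → (∀ n, ‖g n‖ ≤ 1) →
    ¬ IsPeriodicUpTo g (Real.log x ^ K) → ∀ y : ℝ, 0 ≤ y → y ≤ x / A →
      (∑ a ∈ rows A q u, ‖∑ b ∈ (cols x A q v).filter (fun b : ℕ => (b : ℝ) ≤ y),
          g b * (L ((a : ℤ) * b + c) : ℂ)‖ ^ 2) < (A / q) * (x / (A * q)) ^ 2 / Real.log x ^ C'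

/-- The SAME residual with NO proviso on `g` at all: every completely multiplicative 1-bounded
column weight (periodic or not: constants, every Dirichlet character, every `χ·n^{it}` pretender
restricted to the columns, …) fails to be a CM witness of the section. -/
def AllCMSections (c : ℤ) (x A : ℝ) (q u v : ℕ) (C' : ℝ) : Prop :=
  ∀ g : ℕ → ℂ, g 1 = 1 → (∀ m n : ℕ, g (m * n) = g m * g n) → (∀ n, ‖g n‖ ≤ 1) →
    ∀ y : ℝ, 0 ≤ y → y ≤ x / A →
      (∑ a ∈ rows A q u, ‖∑ b ∈ (cols x A q v).filter (fun b : ℕ => (b : ℝ) ≤ y),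
          g b * (L ((a : ℤ) * b + c) : ℂ)‖ ^ 2) < (A / q) * (x / (A * q)) ^ 2 / Real.log x ^ C'

/-- MAIN LEMMA (void cut): for EVERY `K`, the "aperiodic" stub already bounds every CM weight.
Given CM 1-bounded `g` with `g 1 = 1` and `y ≤ x/A`, kill one prime `p > max(⌊x/A⌋, ⌈(log x)^K⌉)`:
`killPrime g p` is CM, 1-bounded, takes the value `1` at `1`, has no period `≤ (log x)^K`
(`aperiodic_killPrime`: Euler `p^{φ(r)} = 1 + m r`), and has the same column sums on `cols`
(all columns are `≤ ⌊x/A⌋ < p`). No hypothesis on `c, x, A, q, u, v, C', K` is needed. -/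
theorem allCMSections_of_aperiodicSections {c : ℤ} {x A : ℝ} {q u v : ℕ} {C' K : ℝ}
    (h : AperiodicSections c x A q u v C' K) : AllCMSections c x A q u v C' := by
  intro g hg1 hgm hgb y hy0 hy
  obtain ⟨p, hpN, hp⟩ := Nat.exists_infinite_primes (max ⌊x / A⌋₊ ⌈Real.log x ^ K⌉₊ + 1)
  have hpcols : ⌊x / A⌋₊ < p := by
    have := le_max_left ⌊x / A⌋₊ ⌈Real.log x ^ K⌉₊; omega
  have hpK : ⌈Real.log x ^ K⌉₊ < p := by
    have := le_max_right ⌊x / A⌋₊ ⌈Real.log x ^ K⌉₊; omega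
  have hg1ne : g 1 ≠ 0 := by rw [hg1]; exact one_ne_zero
  have hg1' : killPrime g p 1 = 1 := by rw [killPrime_of_not_dvd hp.not_dvd_one, hg1]
  have haper : ¬ IsPeriodicUpTo (killPrime g p) (Real.log x ^ K) := by
    rintro ⟨r, hr1, hrK, hper⟩
    have hrceil : r ≤ ⌈Real.log x ^ K⌉₊ := by
      have : (r : ℝ) ≤ ((⌈Real.log x ^ K⌉₊ : ℕ) : ℝ) := hrK.trans (Nat.le_ceil _)
      exact_mod_cast this
    exact aperiodic_killPrime hg1ne hp hr1 (lt_of_le_of_lt hrceil hpK) hper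
  have hbound := h (killPrime g p) hg1' (killPrime_mul hgm hp) (norm_killPrime_le hgb p) haper y hy0 hy
  have hsame : ∀ a : ℕ,
      ∑ b ∈ (cols x A q v).filter (fun b : ℕ => (b : ℝ) ≤ y), killPrime g p b * (L ((a : ℤ) * b + c) : ℂ)
        = ∑ b ∈ (cols x A q v).filter (fun b : ℕ => (b : ℝ) ≤ y), g b * (L ((a : ℤ) * b + c) : ℂ) := by
    intro a
    refine sum_congr rfl fun b hb => ?_
    have hb' : b ∈ cols x A q v := (mem_filter.1 hb).1
    have hb1 : (1 ≤ b ∧ b ≤ ⌊x / A⌋₊) := (mem_cols.1 hb').1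
    rw [killPrime_of_not_dvd]
    intro hdvd
    have := Nat.le_of_dvd (by omega) hdvd
    omega
  simp_rw [hsame] at hbound
  exact hbound

/-- … in particular the "aperiodic" stub contains the PERIODIC one: the card's provable spine
`RelativeLinnikData ⟹ ThinFamilyBV ⟹ PeriodicSections` is logically redundant in `CardTwoAssembly`. -/
theorem periodicSections_of_aperiodicSections {c : ℤ} {x A : ℝ} {q u v : ℕ} {C' K : ℝ}
    (h : AperiodicSections c x A q u v C' K) : PeriodicSections c x A q u v C' K :=
  fun g hg1 hgm hgb _ y hy0 hy => allCMSections_of_aperiodicSections h g hg1 hgm hgb y hy0 hy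

/-- EXACTNESS: for every `K` the aperiodic stub IS the proviso-free CM residual of the section
("larger `K` = fewer weights" is false: the class of admissible `g` on the columns is the same). -/
theorem aperiodicSections_iff_allCMSections {c : ℤ} {x A : ℝ} {q u v : ℕ} {C' : ℝ} (K : ℝ) :
    AperiodicSections c x A q u v C' K ↔ AllCMSections c x A q u v C' :=
  ⟨allCMSections_of_aperiodicSections, fun h g hg1 hgm hgb _ y hy0 hy => h g hg1 hgm hgb y hy0 hy⟩

/-- COLLAPSE of the card's residual conjunction at every dilation: `(P) ∧ (A) ↔ (A)`. -/
theorem residuals_iff_aperiodic {c : ℤ} {x A : ℝ} {q u v : ℕ} {C' K : ℝ} :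
    (PeriodicSections c x A q u v C' K ∧ AperiodicSections c x A q u v C' K) ↔
      AperiodicSections c x A q u v C' K :=
  ⟨fun h => h.2, fun h => ⟨periodicSections_of_aperiodicSections h, h⟩⟩

end Summit.Parity.GeneralizedHardyLittlewood.Cruxes.DilatedTableChowla.TriageR2K1
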